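import Summits.CriticalPhenomena.PercolationContinuityZ3.Theorems.PercNearOneGluingNoHeavyLowerTailTformSetInduction
import HarnessLib

/-!
# `NoHeavyLowerTail` (stmt-CriticalPhenomena-4575) — the crux from the residual GLUING STEP with open recursion on sets

Support file (prover `prim-hp-5`, hull-port cell, T-form calculus, gen 7; `--supports stmt-CriticalPhenomena-4575`).  No definitions,
no named facts, no sorries.  Corollaries of `Theorems.lspSet_induction_open` (file `…TformSetInduction`) for the class of all weighted
graphs: the registered stub `stub_attachedChampion` and the crux `NoHeavyLowerTail` follow from the gluing step for CHAMPIONS and LIGHT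
multi-sets, where — unlike `Theorems.noHeavyLowerTail_of_gluedChampion` (whose unrestricted predecessor GLUE-ADM has an exact census
counterexample at a non-champion) — the step may use light-star packing at champions for ALL non-relay sets of ALL graphs with fewer
positive pairs, and for all smaller sets at the same number of positive pairs.  This is the induction hypothesis that the reference
transfer one level down consumes (every champion of `w − y`, `y ∈ B`, is a T-witness of every glued star of `w − y`).

* `attachedChampion_of_gluedChampion_open` — the stub;  `noHeavyLowerTail_of_gluedChampion_open` — the crux.
-/

noncomputable section

namespace Summit.CriticalPhenomena.PercolationContinuityZ3.Theorems

open MeasureTheory Set Literature.Probability.LatticeModels Literature.Probability.Percolation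
open scoped Classical BigOperators

/-- **The attached-champion inequality from the residual gluing step (open recursion on sets).**  If the gluing step holds for
every weighted graph — for a champion `q`, a relay `c` and a set `B` of at least two non-relay vertices strictly lighter than `q`,
LSP(w, q, c, B), GIVEN LSP at champions for every nonempty non-relay set of every graph with fewer positive pairs and for every
smaller set of every graph with at most as many positive pairs — then the registered stub `stub_attachedChampion` holds verbatim:
`μ(1 ≤ N ≤ j) ≤ μ(|π(q)| ≤ j, 1 ≤ N)` for every observer `o ∉ A` and champion `q`. [cite: KozmaNitzan2024, Lemma 5 (p. 13)] -/
theorem attachedChampion_of_gluedChampion_open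
    (hGlue : ∀ (n : ℕ) (w : Sym2 (Fin n) → unitInterval) (A B : Finset (Fin n)) (q c : Fin n) (j : ℕ),
      (∀ (n' : ℕ) (w' : Sym2 (Fin n') → unitInterval) (A' B' : Finset (Fin n')) (q' c' : Fin n') (j' : ℕ),
        ((Finset.univ.filter fun e : Sym2 (Fin n') => w' e ≠ 0).card <
            (Finset.univ.filter fun e : Sym2 (Fin n) => w e ≠ 0).card ∨
          ((Finset.univ.filter fun e : Sym2 (Fin n') => w' e ≠ 0).card ≤
            (Finset.univ.filter fun e : Sym2 (Fin n) => w e ≠ 0).card ∧ B'.card < B.card)) →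
        q' ∈ A' → c' ∈ A' → B'.Nonempty → (∀ y ∈ B', y ∉ A') →
        (∀ a ∈ A', (prodBernoulli w').real {ω : BondConfig (Fin n') | (A'.filter fun x => ω ∈ openConn a x).card ≤ j'} ≤
          (prodBernoulli w').real {ω : BondConfig (Fin n') | (A'.filter fun x => ω ∈ openConn q' x).card ≤ j'}) →
        (prodBernoulli w').real {ω : BondConfig (Fin n') |
            (∀ y ∈ B', ω ∉ openConn q' y) ∧
              1 ≤ (A'.filter fun z => ∃ y ∈ B', ω ∈ openConn y z).card ∧
              (A'.filter fun z => ∃ y ∈ B', ω ∈ openConn y z).card ≤ j'} +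
          (prodBernoulli w').real {ω : BondConfig (Fin n') |
            ¬ 1 ≤ (A'.filter fun z => ∃ y ∈ B', ω ∈ openConn y z).card ∧
              (A'.filter fun z => ω ∈ openConn c' z).card ≤ j'} ≤
        (prodBernoulli w').real {ω : BondConfig (Fin n') |
            (∀ y ∈ B', ω ∉ openConn q' y) ∧ (A'.filter fun z => ω ∈ openConn q' z).card ≤ j'}) →
      q ∈ A → c ∈ A → 2 ≤ B.card → (∀ y ∈ B, y ∉ A) →
      (∀ a ∈ A, (prodBernoulli w).real {ω : BondConfig (Fin n) | (A.filter fun x => ω ∈ openConn a x).card ≤ j} ≤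
        (prodBernoulli w).real {ω : BondConfig (Fin n) | (A.filter fun x => ω ∈ openConn q x).card ≤ j}) →
      (∀ y ∈ B, (prodBernoulli w).real {ω : BondConfig (Fin n) | (A.filter fun x => ω ∈ openConn q x).card ≤ j} <
        (prodBernoulli w).real {ω : BondConfig (Fin n) | (A.filter fun x => ω ∈ openConn y x).card ≤ j}) →
      (prodBernoulli w).real {ω : BondConfig (Fin n) |
          (∀ y ∈ B, ω ∉ openConn q y) ∧
            1 ≤ (A.filter fun z => ∃ y ∈ B, ω ∈ openConn y z).card ∧
            (A.filter fun z => ∃ y ∈ B, ω ∈ openConn y z).card ≤ j} +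
        (prodBernoulli w).real {ω : BondConfig (Fin n) |
          ¬ 1 ≤ (A.filter fun z => ∃ y ∈ B, ω ∈ openConn y z).card ∧
            (A.filter fun z => ω ∈ openConn c z).card ≤ j} ≤
      (prodBernoulli w).real {ω : BondConfig (Fin n) |
          (∀ y ∈ B, ω ∉ openConn q y) ∧ (A.filter fun z => ω ∈ openConn q z).card ≤ j})
    (n : ℕ) (w : Sym2 (Fin n) → unitInterval) (A : Finset (Fin n)) (o q : Fin n) (j : ℕ) (ho : o ∉ A) (hq : q ∈ A)
    (hchamp : ∀ a ∈ A,
      (prodBernoulli w).real {ω : BondConfig (Fin n) | (A.filter fun x => ω ∈ openConn a x).card ≤ j} ≤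
        (prodBernoulli w).real {ω : BondConfig (Fin n) | (A.filter fun x => ω ∈ openConn q x).card ≤ j}) :
    (prodBernoulli w).real {ω : BondConfig (Fin n) |
        1 ≤ (A.filter fun x => ω ∈ openConn o x).card ∧ (A.filter fun x => ω ∈ openConn o x).card ≤ j} ≤
      (prodBernoulli w).real {ω : BondConfig (Fin n) |
        (A.filter fun x => ω ∈ openConn q x).card ≤ j ∧ 1 ≤ (A.filter fun x => ω ∈ openConn o x).card} := by
  haveI : IsProbabilityMeasure (prodBernoulli w) := inferInstance
  set μ := prodBernoulli w with hμ
  -- LSP(w, q, q, {o}) from the induction over the class of all graphs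
  have h := lspSet_induction_open (fun _ _ _ => True) (fun _ _ _ _ _ => trivial)
    (fun n w A B q c j _ ih hq hc hB hBA hch hl =>
      hGlue n w A B q c j (fun n' w' A' B' q' c' j' hlt hq' hc' hB' hBA' hch' =>
        ih n' w' A' B' q' c' j' hlt trivial hq' hc' hB' hBA' hch') hq hc hB hBA hch hl)
    ((Finset.univ.filter fun e : Sym2 (Fin n) => w e ≠ 0).card) 1 n w A {o} q q j le_rfl (by simp) trivial hq hq
    ⟨o, Finset.mem_singleton_self o⟩ (fun y hy => by rw [Finset.mem_singleton.1 hy]; exact ho) hchamp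
  set Nx : Fin n → BondConfig (Fin n) → ℕ := fun x ω => (A.filter fun z => ω ∈ openConn x z).card with hNx
  -- `|π({o})| = |π(o)|`
  have hNo : ∀ ω : BondConfig (Fin n), (A.filter fun z => ∃ y ∈ ({o} : Finset (Fin n)), ω ∈ openConn y z).card = Nx o ω := by
    intro ω
    simp only [hNx]
    congr 1
    refine Finset.filter_congr fun z _ => ⟨fun ⟨x, hx, hxz⟩ => ?_, fun h => ⟨o, Finset.mem_singleton_self o, h⟩⟩
    rw [Finset.mem_singleton.1 hx] at hxz; exact hxz
  have eL : {ω : BondConfig (Fin n) | (∀ y ∈ ({o} : Finset (Fin n)), ω ∉ openConn q y) ∧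
        1 ≤ (A.filter fun z => ∃ y ∈ ({o} : Finset (Fin n)), ω ∈ openConn y z).card ∧
        (A.filter fun z => ∃ y ∈ ({o} : Finset (Fin n)), ω ∈ openConn y z).card ≤ j} =
      {ω : BondConfig (Fin n) | 1 ≤ Nx o ω ∧ Nx o ω ≤ j} \ {ω | ω ∈ openConn q o} := by
    ext ω
    simp only [mem_sdiff, mem_setOf_eq, hNo]
    simp only [Finset.mem_singleton, forall_eq]
    tauto
  have eZ : {ω : BondConfig (Fin n) | ¬ 1 ≤ (A.filter fun z => ∃ y ∈ ({o} : Finset (Fin n)), ω ∈ openConn y z).card ∧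
        (A.filter fun z => ω ∈ openConn q z).card ≤ j} =
      {ω : BondConfig (Fin n) | Nx q ω ≤ j} \ {ω | 1 ≤ Nx o ω} := by
    ext ω
    simp only [mem_sdiff, mem_setOf_eq, hNo]
    exact and_comm
  have eR : {ω : BondConfig (Fin n) | (∀ y ∈ ({o} : Finset (Fin n)), ω ∉ openConn q y) ∧
        (A.filter fun z => ω ∈ openConn q z).card ≤ j} =
      {ω : BondConfig (Fin n) | Nx q ω ≤ j} \ {ω | ω ∈ openConn q o} := by
    ext ω
    simp only [mem_sdiff, mem_setOf_eq, Finset.mem_singleton, forall_eq]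
    tauto
  rw [eL, eZ, eR] at h
  -- on `{q ↔ o}` the events `{1 ≤ N ≤ j}` and `{|π(q)| ≤ j}` coincide
  have hNq_eq : ∀ ω : BondConfig (Fin n), ω ∈ openConn q o → Nx q ω = Nx o ω := by
    intro ω hqo
    have hqo' : (openGraph ω).Reachable q o := hqo
    simp only [hNx]
    congr 1
    refine Finset.filter_congr fun z _ => ⟨fun h => ?_, fun h => ?_⟩
    · exact (show (openGraph ω).Reachable o z from hqo'.symm.trans h)
    · exact (show (openGraph ω).Reachable q z from hqo'.trans h)
  have hNo1 : ∀ ω : BondConfig (Fin n), ω ∈ openConn q o → 1 ≤ Nx o ω := by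
    intro ω hqo
    have hqo' : (openGraph ω).Reachable q o := hqo
    exact Finset.card_pos.2 ⟨q, Finset.mem_filter.2 ⟨hq, (show ω ∈ openConn o q from hqo'.symm)⟩⟩
  have eV : {ω : BondConfig (Fin n) | 1 ≤ Nx o ω ∧ Nx o ω ≤ j} ∩ {ω | ω ∈ openConn q o} =
      {ω : BondConfig (Fin n) | Nx q ω ≤ j} ∩ {ω | ω ∈ openConn q o} := by
    ext ω
    simp only [mem_inter_iff, mem_setOf_eq]
    constructor
    · rintro ⟨⟨_, h2⟩, h3⟩; exact ⟨by rw [hNq_eq ω h3]; exact h2, h3⟩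
    · rintro ⟨h2, h3⟩; exact ⟨⟨hNo1 ω h3, by rw [← hNq_eq ω h3]; exact h2⟩, h3⟩
  have hsplitL := measureReal_inter_add_sdiff (μ := μ) (s := {ω : BondConfig (Fin n) | 1 ≤ Nx o ω ∧ Nx o ω ≤ j})
    (MeasurableSet.of_discrete (s := {ω : BondConfig (Fin n) | ω ∈ openConn q o})) (measure_ne_top _ _)
  have hsplitR := measureReal_inter_add_sdiff (μ := μ) (s := {ω : BondConfig (Fin n) | Nx q ω ≤ j})
    (MeasurableSet.of_discrete (s := {ω : BondConfig (Fin n) | ω ∈ openConn q o})) (measure_ne_top _ _)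
  have hsplitA := measureReal_inter_add_sdiff (μ := μ) (s := {ω : BondConfig (Fin n) | Nx q ω ≤ j})
    (MeasurableSet.of_discrete (s := {ω : BondConfig (Fin n) | 1 ≤ Nx o ω})) (measure_ne_top _ _)
  have es1 : {ω : BondConfig (Fin n) | Nx q ω ≤ j} ∩ {ω | 1 ≤ Nx o ω} = {ω | Nx q ω ≤ j ∧ 1 ≤ Nx o ω} := by
    ext ω; simp only [mem_inter_iff, mem_setOf_eq]
  rw [eV] at hsplitL
  rw [es1] at hsplitA
  change μ.real {ω | 1 ≤ Nx o ω ∧ Nx o ω ≤ j} ≤ μ.real {ω | Nx q ω ≤ j ∧ 1 ≤ Nx o ω}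
  have h0 : 0 ≤ μ.real ({ω : BondConfig (Fin n) | Nx q ω ≤ j} \ {ω | 1 ≤ Nx o ω}) := measureReal_nonneg
  linarith

/-- **The crux from the residual gluing step with open recursion on sets** (`NoHeavyLowerTail` ⟸ `hGlue`): the corrected and
STRENGTHENED form of `noHeavyLowerTail_of_gluedChampion` — the gluing step for a champion and a light multi-set may now use
light-star packing at champions for all non-relay sets of all graphs with fewer positive pairs (e.g. that every champion of
`w − y` is a T-witness of every glued star of `w − y`), and for all smaller sets at the same number of positive pairs.
[cite: KozmaNitzan2024, Lemma 5 (p. 13)] -/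
theorem noHeavyLowerTail_of_gluedChampion_open
    (hGlue : ∀ (n : ℕ) (w : Sym2 (Fin n) → unitInterval) (A B : Finset (Fin n)) (q c : Fin n) (j : ℕ),
      (∀ (n' : ℕ) (w' : Sym2 (Fin n') → unitInterval) (A' B' : Finset (Fin n')) (q' c' : Fin n') (j' : ℕ),
        ((Finset.univ.filter fun e : Sym2 (Fin n') => w' e ≠ 0).card <
            (Finset.univ.filter fun e : Sym2 (Fin n) => w e ≠ 0).card ∨
          ((Finset.univ.filter fun e : Sym2 (Fin n') => w' e ≠ 0).card ≤
            (Finset.univ.filter fun e : Sym2 (Fin n) => w e ≠ 0).card ∧ B'.card < B.card)) →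
        q' ∈ A' → c' ∈ A' → B'.Nonempty → (∀ y ∈ B', y ∉ A') →
        (∀ a ∈ A', (prodBernoulli w').real {ω : BondConfig (Fin n') | (A'.filter fun x => ω ∈ openConn a x).card ≤ j'} ≤
          (prodBernoulli w').real {ω : BondConfig (Fin n') | (A'.filter fun x => ω ∈ openConn q' x).card ≤ j'}) →
        (prodBernoulli w').real {ω : BondConfig (Fin n') |
            (∀ y ∈ B', ω ∉ openConn q' y) ∧
              1 ≤ (A'.filter fun z => ∃ y ∈ B', ω ∈ openConn y z).card ∧
              (A'.filter fun z => ∃ y ∈ B', ω ∈ openConn y z).card ≤ j'} +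
          (prodBernoulli w').real {ω : BondConfig (Fin n') |
            ¬ 1 ≤ (A'.filter fun z => ∃ y ∈ B', ω ∈ openConn y z).card ∧
              (A'.filter fun z => ω ∈ openConn c' z).card ≤ j'} ≤
        (prodBernoulli w').real {ω : BondConfig (Fin n') |
            (∀ y ∈ B', ω ∉ openConn q' y) ∧ (A'.filter fun z => ω ∈ openConn q' z).card ≤ j'}) →
      q ∈ A → c ∈ A → 2 ≤ B.card → (∀ y ∈ B, y ∉ A) →
      (∀ a ∈ A, (prodBernoulli w).real {ω : BondConfig (Fin n) | (A.filter fun x => ω ∈ openConn a x).card ≤ j} ≤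
        (prodBernoulli w).real {ω : BondConfig (Fin n) | (A.filter fun x => ω ∈ openConn q x).card ≤ j}) →
      (∀ y ∈ B, (prodBernoulli w).real {ω : BondConfig (Fin n) | (A.filter fun x => ω ∈ openConn q x).card ≤ j} <
        (prodBernoulli w).real {ω : BondConfig (Fin n) | (A.filter fun x => ω ∈ openConn y x).card ≤ j}) →
      (prodBernoulli w).real {ω : BondConfig (Fin n) |
          (∀ y ∈ B, ω ∉ openConn q y) ∧
            1 ≤ (A.filter fun z => ∃ y ∈ B, ω ∈ openConn y z).card ∧
            (A.filter fun z => ∃ y ∈ B, ω ∈ openConn y z).card ≤ j} +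
        (prodBernoulli w).real {ω : BondConfig (Fin n) |
          ¬ 1 ≤ (A.filter fun z => ∃ y ∈ B, ω ∈ openConn y z).card ∧
            (A.filter fun z => ω ∈ openConn c z).card ≤ j} ≤
      (prodBernoulli w).real {ω : BondConfig (Fin n) |
          (∀ y ∈ B, ω ∉ openConn q y) ∧ (A.filter fun z => ω ∈ openConn q z).card ≤ j}) :
    Summit.CriticalPhenomena.PercolationContinuityZ3.Theses.PercNearOneGluing.NoHeavyLowerTail :=
  noHeavyLowerTail_of_attachedChampion fun n w A o q j ho hq hchamp =>
    attachedChampion_of_gluedChampion_open hGlue n w A o q j ho hq hchamp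

end Summit.CriticalPhenomena.PercolationContinuityZ3.Theorems

end
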